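import Literature.Analysis.FluidPDE.TransportGalerkin
import HarnessLib

/-!
# The Fourier–Galerkin scheme for the linear transport equation on `T^d`, II: the scheme of
  order `N`, uniform `L²` bound, equicontinuity of the Fourier coefficients

Analysis/FluidPDE proof-support file, second of the discharge of
`Torus.BardosTitiWiedemann2012_transportExistence` (`TransportWeakExistence`; Bardos–Titi–Wiedemann
2012, proof of Cor. 2; DiPerna–Lions 1989, Prop. II.1) for velocities weakly continuous into `L²`
(see `TransportGalerkin` for the truncated system). For a velocity `b` with `L²` slices of
uniformly bounded norm, weakly continuous into `L²` and weakly divergence free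
(`Torus.GalerkinVelocity b B`, the hypotheses after clamping time to `[0, ∞)`) and a real datum
`w₀`, the scheme of order `N` is the real Galerkin solution `α_N` on the frequency ball
`freqBall N` issued from the truncated coefficients of `w₀` (`Torus.truncCoeff`,
`Torus.galerkinCoeff`, chosen by `exists_transportGalerkin_solution`), and the approximation
`W_N(t) = galerkinPoly (freqBall N) (α_N t)` (`Torus.galerkinApprox`; `W_N(0) = P_N w₀`,
`galerkinApprox_zero`). Proved here (Robinson–Rodrigo–Sadowski 2016, Thm. 4.4 Step 3 and
Exercise 4.2 for the Navier–Stokes analogue):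

* the **uniform `L²` bound** `∫ W_N(t)² ≤ ∫ w₀²` (`integral_sq_galerkinApprox_le`: conservation
  and Bessel);
* the **frequency-wise bound** `‖G(v, c)_k‖ ≤ π |k|₁ (∫ w² + ∫ ‖v‖²)`, independent of the
  truncation (`norm_transportGalerkinRHS_apply_le`), hence
  `‖α_N'(t)_k‖ ≤ π |k|₁ (∫ w₀² + B)` (`norm_rhs_galerkinCoeff_le`);
* the **equi-Lipschitz estimate** for the Fourier coefficients `𝓕(W_N(t))(k)`
  (`Torus.galerkinCoeffAt`, `mFourierCoeff_galerkinApprox`), uniformly in `N`: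
  `‖𝓕(W_N(t))(k) - 𝓕(W_N(s))(k)‖ ≤ π |k|₁ (∫ w₀² + B) |t - s|` (`norm_galerkinCoeffAt_sub_le`, mean
  value inequality), together with the uniform bound `‖𝓕(W_N(t))(k)‖² ≤ ∫ w₀²` and conjugate
  symmetry.

These are the inputs of the diagonal extraction and of the identification of the limit in the
sequel.

## References

* C. Bardos, E. S. Titi, E. Wiedemann, C. R. Math. Acad. Sci. Paris 350 (2012) 757–760, proof of
  Cor. 2 (`BardosTitiWiedemann2012`).
* R. J. DiPerna, P.-L. Lions, Invent. Math. 98 (1989) 511–547, Prop. II.1 (`DiPernaLions1989Invent`).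
* J. C. Robinson, J. L. Rodrigo, W. Sadowski, *The three-dimensional Navier–Stokes equations*
  (CUP 2016), Thm. 4.4 Step 3, Exercise 4.2 (`RobinsonRodrigoSadowski2016`).
-/

open MeasureTheory Set Filter Topology Function UnitAddTorus Metric
open scoped ENNReal NNReal InnerProductSpace ComplexConjugate

noncomputable section

namespace Literature.Analysis.FluidPDE

namespace Torus

open Literature.Analysis.FunctionSpaces.Torus

variable {d : Type*} [Fintype d] [DecidableEq d]

/-! ## A frequency-wise bound on the Galerkin field, uniform in the truncation -/

section ModeBound

variable {S : Finset (d → ℤ)}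

omit [DecidableEq d] in
/-- `|a b| ≤ (a² + b²)/2`-integrated: `∫ |w| ‖v‖ ≤ (∫ w² + ∫ ‖v‖²)/2` for `L²` data. [folklore] -/
theorem integral_abs_mul_norm_le {w : UnitAddTorus d → ℝ} {v : UnitAddTorus d → EuclideanSpace ℝ d}
    (hw : MemLp w 2 volume) (hv : MemLp v 2 volume) :
    ∫ x, |w x| * ‖v x‖ ≤ ((∫ x, w x ^ 2) + ∫ x, ‖v x‖ ^ 2) / 2 := by
  have hw2 : Integrable (fun x => w x ^ 2) volume := by
    simpa using hw.integrable_norm_pow two_ne_zero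
  have hv2 : Integrable (fun x => ‖v x‖ ^ 2) volume := hv.integrable_norm_pow two_ne_zero
  have hprod : Integrable (fun x => |w x| * ‖v x‖) volume := by
    have h := hw.norm.integrable_mul hv.norm
    exact h.congr (ae_of_all _ fun x => by simp [Real.norm_eq_abs])
  calc ∫ x, |w x| * ‖v x‖ ≤ ∫ x, (w x ^ 2 + ‖v x‖ ^ 2) / 2 := by
        refine integral_mono hprod ((hw2.add hv2).div_const 2) fun x => ?_
        have h := abs_nonneg (w x)
        nlinarith [sq_nonneg (|w x| - ‖v x‖), sq_abs (w x), norm_nonneg (v x)]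
    _ = ((∫ x, w x ^ 2) + ∫ x, ‖v x‖ ^ 2) / 2 := by
        rw [integral_div, integral_add hw2 hv2]

omit [DecidableEq d] in
/-- **Frequency-wise bound**: `‖G(v, c)_k‖ ≤ π (∑ⱼ |kⱼ|) (∫ w² + ∫ ‖v‖²)`, `w = galerkinPoly S c`
(independent of the size of `S`). [folklore] -/
theorem norm_transportGalerkinRHS_apply_le {v : UnitAddTorus d → EuclideanSpace ℝ d}
    (hv : MemLp v 2 volume) (c : ↥S → ℂ) (k : ↥S) :
    ‖transportGalerkinRHS S v c k‖ ≤
      Real.pi * (∑ j, |(((k : d → ℤ) j : ℤ) : ℝ)|) * ((∫ x, galerkinPoly S c x ^ 2) + ∫ x, ‖v x‖ ^ 2) := by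
  have hw : MemLp (galerkinPoly S c) 2 volume := memLp_reTrigPoly _ _ 2
  have hv1 : Integrable v volume := hv.integrable one_le_two
  set E : ℝ := (∫ x, galerkinPoly S c x ^ 2) + ∫ x, ‖v x‖ ^ 2 with hE
  have hE0 : 0 ≤ E := add_nonneg (integral_nonneg fun x => sq_nonneg _) (integral_nonneg fun x => sq_nonneg _)
  have hF : ∀ j, ‖mFourierCoeff (fun x => ((galerkinPoly S c x * v x j : ℝ) : ℂ)) (k : d → ℤ)‖ ≤ E / 2 := by
    intro j
    rw [mFourierCoeff_eq_integral_volume]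
    calc ‖∫ x, mFourier (-(k : d → ℤ)) x • ((galerkinPoly S c x * v x j : ℝ) : ℂ)‖
        ≤ ∫ x, ‖mFourier (-(k : d → ℤ)) x • ((galerkinPoly S c x * v x j : ℝ) : ℂ)‖ := norm_integral_le_integral_norm _
      _ ≤ ∫ x, |galerkinPoly S c x| * ‖v x‖ := by
          refine integral_mono_of_nonneg (ae_of_all _ fun x => norm_nonneg _)
            ((hw.norm.integrable_mul hv.norm).congr (ae_of_all _ fun x => by simp [Real.norm_eq_abs]))
            (ae_of_all _ fun x => ?_)
          show ‖mFourier (-(k : d → ℤ)) x • ((galerkinPoly S c x * v x j : ℝ) : ℂ)‖ ≤ |galerkinPoly S c x| * ‖v x‖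
          rw [norm_smul, Complex.norm_real, norm_mul, Real.norm_eq_abs]
          calc ‖mFourier (-(k : d → ℤ)) x‖ * (|galerkinPoly S c x| * ‖v x j‖) ≤ 1 * (|galerkinPoly S c x| * ‖v x j‖) :=
                mul_le_mul_of_nonneg_right
                  (((mFourier (-(k : d → ℤ))).norm_coe_le_norm x).trans_eq mFourier_norm) (by positivity)
            _ ≤ |galerkinPoly S c x| * ‖v x‖ := by
                rw [one_mul]
                exact mul_le_mul_of_nonneg_left (PiLp.norm_apply_le (v x) j) (abs_nonneg _)
      _ ≤ E / 2 := integral_abs_mul_norm_le hw hv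
  rw [transportGalerkinRHS, norm_mul]
  have h2π : ‖-(2 * (Real.pi : ℂ) * Complex.I)‖ = 2 * Real.pi := by
    rw [norm_neg, norm_mul, norm_mul, Complex.norm_I, mul_one, Complex.norm_ofNat, Complex.norm_real,
      Real.norm_of_nonneg Real.pi_pos.le]
  rw [h2π]
  calc 2 * Real.pi * ‖∑ j, ((((k : d → ℤ) j : ℝ) : ℂ)) * mFourierCoeff (fun x => ((galerkinPoly S c x * v x j : ℝ) : ℂ)) (k : d → ℤ)‖
      ≤ 2 * Real.pi * ∑ j, |(((k : d → ℤ) j : ℤ) : ℝ)| * (E / 2) := by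
        refine mul_le_mul_of_nonneg_left ((norm_sum_le _ _).trans (Finset.sum_le_sum fun j _ => ?_)) (by positivity)
        rw [norm_mul, Complex.norm_real, Real.norm_eq_abs]
        exact mul_le_mul_of_nonneg_left (hF j) (abs_nonneg _)
    _ = Real.pi * (∑ j, |(((k : d → ℤ) j : ℤ) : ℝ)|) * E := by rw [← Finset.sum_mul]; ring

omit [DecidableEq d] in
/-- The `L²` norm of a real Galerkin polynomial is the coefficient energy. [folklore] -/
theorem integral_sq_galerkinPoly (hS : ∀ k ∈ S, -k ∈ S) {c : ↥S → ℂ} (hc : IsRealScalarCoeff c) :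
    ∫ x, galerkinPoly S c x ^ 2 = ∑ k, ‖c k‖ ^ 2 := by
  rw [galerkinPoly, integral_sq_reTrigPoly hS (hc.isConjSymmScalar hS),
    sum_scalarCoeffExt (fun _ z => ‖z‖ ^ 2)]

end ModeBound

/-! ## The Galerkin scheme of order `N` for the transport equation -/

section Scheme

/-- The truncated Fourier coefficients of a real datum on the frequency ball of radius `N`. [folklore] -/
def truncCoeff (N : ℕ) (w₀ : UnitAddTorus d → ℝ) : ↥(freqBall (d := d) N) → ℂ :=
  fun k => mFourierCoeff (fun x => ((w₀ x : ℝ) : ℂ)) (k : d → ℤ)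

/-- The truncated coefficients are real (conjugate symmetric). [folklore] -/
theorem isRealScalarCoeff_truncCoeff (N : ℕ) (w₀ : UnitAddTorus d → ℝ) :
    IsRealScalarCoeff (truncCoeff N w₀) := by
  intro k l hkl
  simp only [truncCoeff, hkl]
  exact isConjSymmScalar_mFourierCoeff w₀ (k : d → ℤ)

/-- The Galerkin polynomial of the truncated coefficients is the Fourier truncation `P_N w₀`. [folklore] -/
theorem galerkinPoly_truncCoeff (N : ℕ) (w₀ : UnitAddTorus d → ℝ) :
    galerkinPoly (freqBall N) (truncCoeff N w₀) = scalarTruncate N w₀ := by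
  have h : trigPoly (freqBall N) (scalarCoeffExt (freqBall N) (truncCoeff N w₀)) =
      trigPoly (freqBall N) (fun k => mFourierCoeff (fun x => ((w₀ x : ℝ) : ℂ)) k) :=
    trigPoly_congr fun k hk => by rw [scalarCoeffExt_of_mem _ hk]; rfl
  funext x
  show (trigPoly (freqBall N) (scalarCoeffExt (freqBall N) (truncCoeff N w₀)) x).re =
    (trigPoly (freqBall N) (fun k => mFourierCoeff (fun x => ((w₀ x : ℝ) : ℂ)) k) x).re
  rw [h]

/-- Bessel: the truncated coefficient energy is at most `‖w₀‖²_{L²}`. [folklore] -/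
theorem sum_norm_sq_truncCoeff_le (N : ℕ) {w₀ : UnitAddTorus d → ℝ} (hw₀ : MemLp w₀ 2 volume) :
    ∑ k, ‖truncCoeff N w₀ k‖ ^ 2 ≤ ∫ x, w₀ x ^ 2 := by
  have h := sum_sq_norm_mFourierCoeff_le_integral_sq hw₀ N
  rwa [← Finset.sum_coe_sort] at h

variable {b : ℝ → UnitAddTorus d → EuclideanSpace ℝ d} {B : ℝ} {w₀ : UnitAddTorus d → ℝ}

/-- **The standing hypotheses on the velocity of the Galerkin scheme** (after clamping time to
`[0, ∞)`): `L²` slices with `∫ ‖b t‖² ≤ B`, weak continuity into `L²` on every `[0, T]`, weak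
incompressibility for every `t ≥ 0`. [folklore] -/
structure GalerkinVelocity (b : ℝ → UnitAddTorus d → EuclideanSpace ℝ d) (B : ℝ) : Prop where
  memLp : ∀ t, 0 ≤ t → MemLp (b t) 2 volume
  sq_le : ∀ t, 0 ≤ t → ∫ x, ‖b t x‖ ^ 2 ≤ B
  weaklyContinuous : ∀ T : ℝ, ∀ g : UnitAddTorus d → EuclideanSpace ℝ d, MemLp g 2 volume →
    ContinuousOn (fun t => ∫ x, ⟪b t x, g x⟫_ℝ) (Icc 0 T)
  divFree : ∀ t, 0 ≤ t → IsWeaklyDivFree (b t)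

/-- `∫ ‖f‖ ≤ 1 + ∫ ‖f‖²` on a probability space (private copy of the bookkeeping lemma of
`TwoHalfWeakEuler`, to keep the import closure of the Galerkin files small). [folklore] -/
private theorem integral_norm_le_one_add' {α : Type*} [MeasurableSpace α] {μ : Measure α} [IsProbabilityMeasure μ]
    {E : Type*} [NormedAddCommGroup E] {f : α → E} (hf : MemLp f 2 μ) :
    ∫ x, ‖f x‖ ∂μ ≤ 1 + ∫ x, ‖f x‖ ^ 2 ∂μ := by
  have h2 : Integrable (fun x => ‖f x‖ ^ 2) μ := hf.integrable_norm_pow two_ne_zero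
  have h1 : Integrable (fun x => ‖f x‖) μ := (hf.integrable one_le_two).norm
  calc ∫ x, ‖f x‖ ∂μ ≤ ∫ x, (1 + ‖f x‖ ^ 2) ∂μ := by
        refine integral_mono h1 ((integrable_const 1).add h2) fun y => ?_
        nlinarith [sq_nonneg (‖f y‖ - 1), norm_nonneg (f y)]
    _ = 1 + ∫ x, ‖f x‖ ^ 2 ∂μ := by
        rw [integral_add (integrable_const 1) h2, integral_const]
        simp

namespace GalerkinVelocity

omit [DecidableEq d] in
/-- Integrable slices. [folklore] -/
theorem integrable (hb : GalerkinVelocity b B) (t : ℝ) (ht : 0 ≤ t) : Integrable (b t) volume :=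
  (hb.memLp t ht).integrable one_le_two

omit [DecidableEq d] in
/-- `L¹` bound of the slices: `∫ ‖b t‖ ≤ 1 + B`. [folklore] -/
theorem norm_le (hb : GalerkinVelocity b B) (t : ℝ) (ht : 0 ≤ t) : ∫ x, ‖b t x‖ ≤ 1 + B :=
  (integral_norm_le_one_add' (hb.memLp t ht)).trans (by linarith [hb.sq_le t ht])

omit [DecidableEq d] in
/-- The constant is nonnegative. [folklore] -/
theorem nonneg (hb : GalerkinVelocity b B) : 0 ≤ B :=
  (integral_nonneg fun x => sq_nonneg ‖b 0 x‖).trans (hb.sq_le 0 le_rfl)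

end GalerkinVelocity

/-- **The Galerkin coefficient curve of order `N`**: a real solution of `α' = G(b(t), α)` on
`[0, ∞)` with `α 0` the truncated coefficients of `w₀` and conserved coefficient energy
(chosen by `exists_transportGalerkin_solution`). [folklore] -/
def galerkinCoeff (hb : GalerkinVelocity b B) (w₀ : UnitAddTorus d → ℝ) (N : ℕ) : ℝ → ↥(freqBall (d := d) N) → ℂ :=
  (exists_transportGalerkin_solution (S := freqBall N) neg_mem_freqBall_of_mem hb.integrable hb.norm_le
    hb.weaklyContinuous hb.divFree (isRealScalarCoeff_truncCoeff N w₀)).choose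

/-- The defining properties of the Galerkin coefficient curve. [folklore] -/
theorem galerkinCoeff_spec (hb : GalerkinVelocity b B) (w₀ : UnitAddTorus d → ℝ) (N : ℕ) :
    galerkinCoeff hb w₀ N 0 = truncCoeff N w₀ ∧ (∀ t, IsRealScalarCoeff (galerkinCoeff hb w₀ N t)) ∧
      (∀ T, ∀ t ∈ Icc 0 T, HasDerivWithinAt (galerkinCoeff hb w₀ N)
        (transportGalerkinRHS (freqBall N) (b t) (galerkinCoeff hb w₀ N t)) (Icc 0 T) t) ∧
      ∀ t, 0 ≤ t → ∑ k, ‖galerkinCoeff hb w₀ N t k‖ ^ 2 = ∑ k, ‖truncCoeff N w₀ k‖ ^ 2 :=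
  (exists_transportGalerkin_solution (S := freqBall N) neg_mem_freqBall_of_mem hb.integrable hb.norm_le
    hb.weaklyContinuous hb.divFree (isRealScalarCoeff_truncCoeff N w₀)).choose_spec

/-- **The Galerkin approximation of order `N`**: `W_N(t) = galerkinPoly (freqBall N) (α_N t)`. [folklore] -/
def galerkinApprox (hb : GalerkinVelocity b B) (w₀ : UnitAddTorus d → ℝ) (N : ℕ) : ℝ → UnitAddTorus d → ℝ :=
  fun t => galerkinPoly (freqBall N) (galerkinCoeff hb w₀ N t)

/-- The initial slice of the approximation is the truncation `P_N w₀`. [folklore] -/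
theorem galerkinApprox_zero (hb : GalerkinVelocity b B) (w₀ : UnitAddTorus d → ℝ) (N : ℕ) :
    galerkinApprox hb w₀ N 0 = scalarTruncate N w₀ := by
  rw [galerkinApprox, (galerkinCoeff_spec hb w₀ N).1, galerkinPoly_truncCoeff]

/-- **Uniform `L²` bound**: `∫ W_N(t)² ≤ ∫ w₀²` for `t ≥ 0` (conservation and Bessel). [folklore] -/
theorem integral_sq_galerkinApprox_le (hb : GalerkinVelocity b B) (hw₀ : MemLp w₀ 2 volume) (N : ℕ)
    {t : ℝ} (ht : 0 ≤ t) : ∫ x, galerkinApprox hb w₀ N t x ^ 2 ≤ ∫ x, w₀ x ^ 2 := by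
  obtain ⟨-, hreal, -, hcons⟩ := galerkinCoeff_spec hb w₀ N
  rw [galerkinApprox, integral_sq_galerkinPoly neg_mem_freqBall_of_mem (hreal t), hcons t ht]
  exact sum_norm_sq_truncCoeff_le N hw₀

/-- The approximations are smooth in space. [folklore] -/
theorem isSmooth_galerkinApprox (hb : GalerkinVelocity b B) (w₀ : UnitAddTorus d → ℝ) (N : ℕ) (t : ℝ) :
    IsSmooth (galerkinApprox hb w₀ N t) := isSmooth_galerkinPoly _

end Scheme

/-! ## Equicontinuity of the Fourier coefficients of the approximations -/

section Equicontinuity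

variable {b : ℝ → UnitAddTorus d → EuclideanSpace ℝ d} {B : ℝ} {w₀ : UnitAddTorus d → ℝ}

/-- The frequency weight `∑ⱼ |kⱼ|`. [folklore] -/
def freqWeight (k : d → ℤ) : ℝ := ∑ j, |((k j : ℤ) : ℝ)|

omit [DecidableEq d] in
/-- The frequency weight is nonnegative. [folklore] -/
theorem freqWeight_nonneg (k : d → ℤ) : 0 ≤ freqWeight k := Finset.sum_nonneg fun j _ => abs_nonneg ((k j : ℤ) : ℝ)

/-- **Uniform bound on the time derivative of each Galerkin coefficient**:
`‖G(b(t), α_N(t))_k‖ ≤ π |k|₁ (∫ w₀² + B)` for `t ≥ 0`. [folklore] -/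
theorem norm_rhs_galerkinCoeff_le (hb : GalerkinVelocity b B) (hw₀ : MemLp w₀ 2 volume) (N : ℕ)
    {t : ℝ} (ht : 0 ≤ t) (k : ↥(freqBall (d := d) N)) :
    ‖transportGalerkinRHS (freqBall N) (b t) (galerkinCoeff hb w₀ N t) k‖ ≤
      Real.pi * freqWeight (k : d → ℤ) * ((∫ x, w₀ x ^ 2) + B) := by
  refine (norm_transportGalerkinRHS_apply_le (hb.memLp t ht) _ k).trans ?_
  refine mul_le_mul_of_nonneg_left (add_le_add ?_ (hb.sq_le t ht)) (mul_nonneg Real.pi_pos.le (freqWeight_nonneg _))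
  exact integral_sq_galerkinApprox_le hb hw₀ N ht

/-- **Equi-Lipschitz bound for the Galerkin coefficients** (mean value inequality): for `k` in the
ball and `s, t ∈ [0, T]`, `‖α_N(t)_k - α_N(s)_k‖ ≤ π |k|₁ (∫ w₀² + B) |t - s|`. [folklore] -/
theorem norm_galerkinCoeff_sub_le (hb : GalerkinVelocity b B) (hw₀ : MemLp w₀ 2 volume) (N : ℕ) {T s t : ℝ}
    (hs : s ∈ Icc 0 T) (ht : t ∈ Icc 0 T) (k : ↥(freqBall (d := d) N)) :
    ‖galerkinCoeff hb w₀ N t k - galerkinCoeff hb w₀ N s k‖ ≤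
      Real.pi * freqWeight (k : d → ℤ) * ((∫ x, w₀ x ^ 2) + B) * |t - s| := by
  obtain ⟨-, -, hsol, -⟩ := galerkinCoeff_spec hb w₀ N
  have hk : ∀ τ ∈ Icc 0 T, HasDerivWithinAt (fun τ => galerkinCoeff hb w₀ N τ k)
      (transportGalerkinRHS (freqBall N) (b τ) (galerkinCoeff hb w₀ N τ) k) (Icc 0 T) τ := fun τ hτ =>
    (ContinuousLinearMap.proj (R := ℝ) (φ := fun _ : ↥(freqBall (d := d) N) => ℂ) k).hasFDerivAt.comp_hasDerivWithinAt
      τ (hsol T τ hτ)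
  have h := Convex.norm_image_sub_le_of_norm_hasDerivWithin_le hk
    (fun τ hτ => norm_rhs_galerkinCoeff_le hb hw₀ N hτ.1 k) (convex_Icc 0 T) hs ht
  rwa [Real.norm_eq_abs] at h

/-- **The Fourier coefficients of the approximations**, extended by zero off the ball:
`𝓕(W_N(t))(k)`. [folklore] -/
def galerkinCoeffAt (hb : GalerkinVelocity b B) (w₀ : UnitAddTorus d → ℝ) (N : ℕ) (t : ℝ) (k : d → ℤ) : ℂ :=
  scalarCoeffExt (freqBall N) (galerkinCoeff hb w₀ N t) k

/-- `galerkinCoeffAt` is the Fourier coefficient family of the approximation. [folklore] -/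
theorem mFourierCoeff_galerkinApprox (hb : GalerkinVelocity b B) (w₀ : UnitAddTorus d → ℝ) (N : ℕ) (t : ℝ)
    (k : d → ℤ) :
    mFourierCoeff (fun x => ((galerkinApprox hb w₀ N t x : ℝ) : ℂ)) k = galerkinCoeffAt hb w₀ N t k := by
  obtain ⟨-, hreal, -, -⟩ := galerkinCoeff_spec hb w₀ N
  rw [galerkinApprox, galerkinPoly, mFourierCoeff_ofReal_reTrigPoly neg_mem_freqBall_of_mem
    ((hreal t).isConjSymmScalar neg_mem_freqBall_of_mem), galerkinCoeffAt]
  by_cases hk : k ∈ freqBall N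
  · rw [if_pos hk]
  · rw [if_neg hk, scalarCoeffExt_of_not_mem _ hk]

/-- **Uniform bound**: `‖𝓕(W_N(t))(k)‖² ≤ ∫ w₀²` for `t ≥ 0`. [folklore] -/
theorem norm_galerkinCoeffAt_sq_le (hb : GalerkinVelocity b B) (hw₀ : MemLp w₀ 2 volume) (N : ℕ) {t : ℝ}
    (ht : 0 ≤ t) (k : d → ℤ) : ‖galerkinCoeffAt hb w₀ N t k‖ ^ 2 ≤ ∫ x, w₀ x ^ 2 := by
  obtain ⟨-, -, -, hcons⟩ := galerkinCoeff_spec hb w₀ N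
  by_cases hk : k ∈ freqBall N
  · rw [galerkinCoeffAt, scalarCoeffExt_of_mem _ hk]
    calc ‖galerkinCoeff hb w₀ N t ⟨k, hk⟩‖ ^ 2 ≤ ∑ k', ‖galerkinCoeff hb w₀ N t k'‖ ^ 2 :=
          Finset.single_le_sum (f := fun k' => ‖galerkinCoeff hb w₀ N t k'‖ ^ 2) (fun _ _ => sq_nonneg _)
            (Finset.mem_univ _)
      _ = ∑ k', ‖truncCoeff N w₀ k'‖ ^ 2 := hcons t ht
      _ ≤ ∫ x, w₀ x ^ 2 := sum_norm_sq_truncCoeff_le N hw₀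
  · rw [galerkinCoeffAt, scalarCoeffExt_of_not_mem _ hk, norm_zero, zero_pow two_ne_zero]
    exact integral_nonneg fun x => sq_nonneg _

/-- **Equi-Lipschitz bound for the extended coefficients**, uniform in `N`:
`‖𝓕(W_N(t))(k) - 𝓕(W_N(s))(k)‖ ≤ π |k|₁ (∫ w₀² + B) |t - s|` on `[0, T]`. [folklore] -/
theorem norm_galerkinCoeffAt_sub_le (hb : GalerkinVelocity b B) (hw₀ : MemLp w₀ 2 volume) (N : ℕ) {T s t : ℝ}
    (hs : s ∈ Icc 0 T) (ht : t ∈ Icc 0 T) (k : d → ℤ) :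
    ‖galerkinCoeffAt hb w₀ N t k - galerkinCoeffAt hb w₀ N s k‖ ≤
      Real.pi * freqWeight k * ((∫ x, w₀ x ^ 2) + B) * |t - s| := by
  by_cases hk : k ∈ freqBall N
  · rw [galerkinCoeffAt, galerkinCoeffAt, scalarCoeffExt_of_mem _ hk, scalarCoeffExt_of_mem _ hk]
    exact norm_galerkinCoeff_sub_le hb hw₀ N hs ht ⟨k, hk⟩
  · rw [galerkinCoeffAt, galerkinCoeffAt, scalarCoeffExt_of_not_mem _ hk, scalarCoeffExt_of_not_mem _ hk,
      sub_zero, norm_zero]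
    have h1 : 0 ≤ (∫ x, w₀ x ^ 2) + B := add_nonneg (integral_nonneg fun x => sq_nonneg _) hb.nonneg
    have h2 : 0 ≤ Real.pi * freqWeight k := mul_nonneg Real.pi_pos.le (freqWeight_nonneg k)
    positivity

/-- The extended coefficients are conjugate symmetric. [folklore] -/
theorem galerkinCoeffAt_neg (hb : GalerkinVelocity b B) (w₀ : UnitAddTorus d → ℝ) (N : ℕ) (t : ℝ) (k : d → ℤ) :
    galerkinCoeffAt hb w₀ N t (-k) = conj (galerkinCoeffAt hb w₀ N t k) := by
  obtain ⟨-, hreal, -, -⟩ := galerkinCoeff_spec hb w₀ N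
  exact (hreal t).isConjSymmScalar neg_mem_freqBall_of_mem k

end Equicontinuity

end Torus

end Literature.Analysis.FluidPDE

end
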